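import Mathlib
import HarnessLib
import Literature.Analysis.FluidPDE.PineauVicolBernoulli
import Summits.NavierStokesRegularity.NavierStokesRegularity.Theses.LocalPressureProfileDoor
import Summits.NavierStokesRegularity.NavierStokesRegularity.Theorems.LocalPressureProfileDoorMonotonePressureProfileRigidityPeriodicLiouville
import Summits.NavierStokesRegularity.NavierStokesRegularity.Theorems.DssFarFieldSlavingBlowupTypeIDssProfileCorotatingProfileHypotheses
import Summits.NavierStokesRegularity.NavierStokesRegularity.Theorems.DssFarFieldSlavingBlowupTypeIDssProfileGaussianTypeIPackage
import Summits.NavierStokesRegularity.NavierStokesRegularity.Theorems.PoloidalWindowDoorPoloidalWindowRigidityDegenerate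

/-!
# Route `LocalPressureProfileDoor`, crux K2⁺ `MonotonePressureProfileRigidity` (stmt-NavierStokesRegularity-20180), line `birth`:
# the BC5 rung `stub_rung_dssSteadyPressure` — a λ-DSS door-class profile with STEADY similarity Riesz pressure has a regular apex

Cell ns-regularity-ideate, seat ns-pressure-K2-p1 (LEAD on the crux; registered stub of the skeleton `Lines/birth.lean`, sha 86b6bcf2…,
signature VERBATIM; lands `--supports stmt-NavierStokesRegularity-20180`).

**Statement (the rung).**  Let `v` be a profile of the door class — Type I in time (`C`), space–time Type-I decay (`D`), continuous on
the open backward slab, unit-viscosity Oseen–Duhamel identity between negative times, divergence-free slices — which is `λ`-discretely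
self-similar (`1 < λ`) and whose similarity Riesz pressure `(−t)·Q[v(t)](√(−t) y)` (`Q = pressurePotential`) does not depend on `t`.
Then `v` is not backward-singular at the apex `(0, 0)`; in fact `v ≡ 0` on `t < 0`.

**Proof (no adjoint weight is needed in this stratum).**  In Leray variables `s = −log(−t)`, `U(s) = lerayOrbit v s`, the tree's
hypothesis package `GaussianHeadPressure.typeI_rdss_corotatingProfile_hypotheses` (run with twist `θ = 0`) gives: `U` jointly smooth and
`2 log λ`-periodic, the slice equations `∂ₛU + ½U + ½(y·∇)U − ΔU + (U·∇)U + ∇P = 0`, `div U = 0` with `P(·, s)` the similarity Riesz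
pressure of the statement, the trace Poisson equation `ΔP = −tr((∇U)²)`, and the bound `|U| ≤ K/(1+|y|)`; the similarity Riesz pressure
is bounded (`exists_bound_abs_pressurePotential_lerayOrbit`) and, by hypothesis, equal to ONE function `P₀` for all `s`.  Pineau–Vicol's
Bernoulli identity ((4.3)/(7.7), tree `PineauVicol2026.bernoulli_identity_rdss` with `α = 0`) then says that the head pressure
`Π(s) = ½|U(s)|² + P₀ + ½ y·U(s)` is a bounded, periodic, classical solution of `∂ₛΠ + DΠ[U + ½y] − ΔΠ = −|curl U|²`, and the
periodic parabolic Liouville theorem of the companion file (`periodic_dissipation_eq_zero`) kills the dissipation: `curl U ≡ 0`.  A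
curl-free profile of the class vanishes (`…PoloidalWindowRigidityDegenerate.nonflatLiouville_of_irrotational`, via `curl_lerayOrbit`).

* `curl_eq_zero_of_steadyPressure_profile` — the profile-level statement (periodic smooth profile, slice equations, steady pressure);
* `stub_rung_dssSteadyPressure` — the registered rung, verbatim.

WHAT THIS IS NOT: not a claim about Navier–Stokes regularity and not the crux K2⁺ — its discretely-self-similar, steady-pressure
sub-case (bears_on LADDER-NS N0, rung N0-LocalTubeDoorPressureProfile; T1 rule (d) separating witness of the route).
-/

noncomputable section

-- the summit and its single sub-problem share the name (CONVENTIONS §1), as in every Theorems file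
set_option linter.dupNamespace false
-- nested operator types `ℝ³ →L[ℝ] ℝ³ →L[ℝ] ℝ³`
set_option maxSynthPendingDepth 3

namespace Summit.NavierStokesRegularity.NavierStokesRegularity.Theorems.LocalPressureProfileDoorMonotonePressureProfileRigidityRungDssSteadyPressure

open Set Function Filter Topology Metric InnerProductSpace
open scoped RealInnerProductSpace Laplacian ContDiff BigOperators
open Literature.Analysis Literature.Analysis.FluidPDE Literature.Analysis.FluidPDE.PineauVicol2026
open Summit.NavierStokesRegularity.NavierStokesRegularity.Theorems.LocalPressureProfileDoorMonotonePressureProfileRigidityPeriodicLiouville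
open Summit.NavierStokesRegularity.NavierStokesRegularity.Theorems.GaussianHeadPressure
  (typeI_rdss_corotatingProfile_hypotheses exists_bound_abs_pressurePotential_lerayOrbit exp_mul_pressurePotential_eq)
open Summit.NavierStokesRegularity.NavierStokesRegularity.Theorems.GaussianGap (eq_zero_of_lerayVorticity_eq_zero)
open Summit.NavierStokesRegularity.NavierStokesRegularity.Theorems.PoloidalWindowDoorPoloidalWindowRigidityWindow
  (isTypeIAncientMild_of_class)
open Summit.NavierStokesRegularity.NavierStokesRegularity.Theorems.PoloidalWindowDoorPoloidalWindowRigidityFlat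
  (not_backwardSingular_of_zero)

/-! ### The profile-level theorem -/

/-- **A periodic Leray profile with steady pressure is irrotational.**  Let `U : ℝ³ × ℝ → ℝ³` be jointly smooth and `L`-periodic in
`s` (`L > 0`), with smooth pressure slices `P(·, s)`, solving slice by slice the time-dependent Leray system
`∂ₛU + ½U + ½(y·∇)U − ΔU + (U·∇)U + ∇P = 0`, `div U = 0`, with the trace Poisson equation `ΔP = −tr((∇U)²)`, the decay
`|U(y, s)| ≤ K/(1 + |y|)`, a STEADY pressure `P(y, s) = P(y, 0)` bounded by `K'`.  Then `curl U(·, s) ≡ 0` for every `s`: the head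
pressure `Π = ½|U|² + P₀ + ½⟪y, U⟫` is a bounded periodic classical solution of `∂ₛΠ + DΠ[U + ½y] − ΔΠ = −|curl U|²`
(`bernoulli_identity_rdss`, `α = 0`) and `periodic_dissipation_eq_zero` applies with `a = ½`, `b = 0`.
[cite: PineauVicol2026, (4.3) (p. 11) and (7.7) (p. 25); Tsai1998, (1.7)] -/
theorem curl_eq_zero_of_steadyPressure_profile
    {U : EuclideanSpace ℝ (Fin 3) → ℝ → EuclideanSpace ℝ (Fin 3)} {P : EuclideanSpace ℝ (Fin 3) → ℝ → ℝ} {L K K' : ℝ}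
    (hL : 0 < L) (hUj : ContDiff ℝ ∞ (fun q : EuclideanSpace ℝ (Fin 3) × ℝ => U q.1 q.2))
    (hPsl : ∀ s, ContDiff ℝ ∞ fun z => P z s) (hper : ∀ y s, U y (s + L) = U y s)
    (heq : ∀ s y, fderiv ℝ (fun σ => U y σ) s 1 + (1 / 2 : ℝ) • U y s + (1 / 2 : ℝ) • fderiv ℝ (fun z => U z s) y y -
        (Δ (fun z => U z s)) y + convect (fun z => U z s) (fun z => U z s) y + gradient (fun z => P z s) y = 0)
    (hdiv : ∀ s, VectorCalculus.IsDivFree fun z => U z s)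
    (hΔP : ∀ s y, ∑ l, pderiv l (pderiv l fun z => P z s) y =
      -∑ l, ∑ j, pderiv l (fun z => U z s j) y * pderiv j (fun z => U z s l) y)
    (hUb : ∀ s y, ‖U y s‖ ≤ K / (1 + ‖y‖)) (hsteady : ∀ y s, P y s = P y 0) (hPb : ∀ y, |P y 0| ≤ K') :
    ∀ s y, curl (fun z => U z s) y = 0 := by
  have hK0 : 0 ≤ K := by
    have h := hUb 0 0
    rw [norm_zero, add_zero, div_one] at h
    exact (norm_nonneg _).trans h
  -- the steady pressure `P₀` and the slice equation with it
  set P₀ : EuclideanSpace ℝ (Fin 3) → ℝ := fun z => P z 0 with hP₀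
  have hPs : ∀ s, (fun z => P z s) = P₀ := fun s => funext fun z => hsteady z s
  have hP₀2 : ContDiff ℝ ∞ P₀ := hPs 0 ▸ hPsl 0
  have hUsl : ∀ s, ContDiff ℝ ∞ (fun z => U z s) := fun s => hUj.comp (contDiff_id.prodMk contDiff_const)
  -- the objects: head pressure, its time derivative, the dissipation, the drift perturbation
  set Us : EuclideanSpace ℝ (Fin 3) → ℝ → EuclideanSpace ℝ (Fin 3) := fun y s => fderiv ℝ (fun σ => U y σ) s 1 with hUs
  set Θ : ℝ → EuclideanSpace ℝ (Fin 3) → ℝ := fun s => headPressure (1 / 2) (fun z => U z s) P₀ with hΘ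
  set Θt : ℝ → EuclideanSpace ℝ (Fin 3) → ℝ := fun s y => ⟪U y s + (1 / 2 : ℝ) • y, Us y s⟫ with hΘt
  set Dd : ℝ → EuclideanSpace ℝ (Fin 3) → ℝ := fun s y => ‖curl (fun z => U z s) y‖ ^ 2 with hDd
  set W : ℝ → EuclideanSpace ℝ (Fin 3) → EuclideanSpace ℝ (Fin 3) := fun s y => U y s with hW
  have hΘapply : ∀ s y, Θ s y = 2⁻¹ * ‖U y s‖ ^ 2 + P₀ y + 1 / 2 * ⟪y, U y s⟫ := fun s y => by
    simp only [hΘ, headPressure_apply]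
  -- periodicity, continuity, smoothness of slices
  have hΘper : Function.Periodic Θ L := fun s => by
    funext y; rw [hΘapply, hΘapply, hper]
  have hUc : Continuous fun p : ℝ × EuclideanSpace ℝ (Fin 3) => U p.2 p.1 :=
    hUj.continuous.comp (continuous_snd.prodMk continuous_fst)
  have hΘcont : Continuous (uncurry Θ) := by
    have e : uncurry Θ = fun p : ℝ × EuclideanSpace ℝ (Fin 3) =>
        2⁻¹ * ‖U p.2 p.1‖ ^ 2 + P₀ p.2 + 1 / 2 * ⟪p.2, U p.2 p.1⟫ := by
      funext p; rcases p with ⟨s, y⟩; simp only [uncurry_apply_pair, hΘapply]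
    rw [e]
    exact ((continuous_const.mul (hUc.norm.pow 2)).add (hP₀2.continuous.comp continuous_snd)).add
      (continuous_const.mul (continuous_snd.inner hUc))
  have hΘ2 : ∀ s, ContDiff ℝ 2 (Θ s) := fun s =>
    (contDiff_headPressure (hUsl s) hP₀2 (1 / 2)).of_le (by norm_cast)
  -- the classical time derivative
  have hUderiv : ∀ y s, HasDerivAt (fun σ => U y σ) (Us y s) s := by
    intro y s
    have hd : Differentiable ℝ (fun σ => U y σ) :=
      (hUj.comp (contDiff_const.prodMk contDiff_id)).differentiable (by simp)
    have h := (hd s).hasDerivAt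
    rwa [show deriv (fun σ => U y σ) s = Us y s from rfl] at h
  have hΘderiv : ∀ y s, HasDerivAt (fun σ => Θ σ y) (Θt s y) s := by
    intro y s
    have h1 := (hUderiv y s).norm_sq
    have h2 := (hasDerivAt_const s y).inner ℝ (hUderiv y s)
    have h3 : HasDerivAt (fun σ => 2⁻¹ * ‖U y σ‖ ^ 2 + P₀ y + 1 / 2 * ⟪y, U y σ⟫)
        (2⁻¹ * (2 * ⟪U y s, Us y s⟫) + 1 / 2 * (⟪y, Us y s⟫ + ⟪(0 : EuclideanSpace ℝ (Fin 3)), U y s⟫)) s :=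
      ((h1.const_mul 2⁻¹).add_const (P₀ y)).add (h2.const_mul (1 / 2))
    have e : (fun σ => 2⁻¹ * ‖U y σ‖ ^ 2 + P₀ y + 1 / 2 * ⟪y, U y σ⟫) = fun σ => Θ σ y := by
      funext σ; rw [hΘapply]
    rw [e] at h3
    convert h3 using 1
    simp only [hΘt, inner_add_left, real_inner_smul_left, inner_zero_left, add_zero]
    ring
  -- the Bernoulli identity: `ΔΘ − DΘ[U + ½y] = |curl U|² + ⟪U + ½y, ∂ₛU⟫`
  have hlaw : ∀ s y, Θt s y + fderiv ℝ (Θ s) y (W s y + (1 / 2 : ℝ) • y) - (Δ (Θ s)) y ≤ -Dd s y := by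
    intro s y
    have heq' : ∀ z, Us z s + (0 : ℝ) • (rotGen (U z s) - fderiv ℝ (fun x => U x s) z (rotGen z)) +
        (1 / 2 : ℝ) • U z s + (1 / 2 : ℝ) • fderiv ℝ (fun x => U x s) z z - (Δ (fun x => U x s)) z +
        convect (fun x => U x s) (fun x => U x s) z + gradient P₀ z = 0 := by
      intro z
      rw [zero_smul, add_zero, ← hPs s]
      exact heq s z
    have hΔP' : ∀ z, ∑ l, pderiv l (pderiv l P₀) z =
        -∑ l, ∑ j, pderiv l (fun x => U x s j) z * pderiv j (fun x => U x s l) z := by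
      intro z; rw [← hPs s]; exact hΔP s z
    have hB := bernoulli_identity_rdss (α := 0) (hUsl s) hP₀2 heq' (hdiv s) hΔP' y
    rw [zero_mul, zero_sub] at hB
    simp only [driftOp, one_mul] at hB
    have e1 : headPressure (1 / 2) (fun z => U z s) P₀ = Θ s := rfl
    rw [e1] at hB
    simp only [hΘt, hDd, hW, hUs]
    linarith
  -- bounds: drift perturbation and head pressure
  have hUb' : ∀ s y, ‖W s y‖ ≤ K + 0 * ‖y‖ := fun s y => by
    rw [zero_mul, add_zero]
    exact (hUb s y).trans (div_le_self hK0 (by linarith [norm_nonneg y]))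
  have hΘbdd : ∀ s y, |Θ s y| ≤ 2⁻¹ * K ^ 2 + K' + 1 / 2 * K := by
    intro s y
    have h1 : ‖U y s‖ ≤ K := (hUb s y).trans (div_le_self hK0 (by linarith [norm_nonneg y]))
    have h2 : ‖U y s‖ ^ 2 ≤ K ^ 2 := pow_le_pow_left₀ (norm_nonneg _) h1 2
    have h3 : |⟪y, U y s⟫| ≤ K := by
      refine (abs_real_inner_le_norm _ _).trans ?_
      have h4 := hUb s y
      rw [le_div_iff₀ (by positivity)] at h4
      nlinarith [norm_nonneg y, norm_nonneg (U y s)]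
    rw [hΘapply]
    have h5 := hPb y
    have h6 : |2⁻¹ * ‖U y s‖ ^ 2| = 2⁻¹ * ‖U y s‖ ^ 2 := abs_of_nonneg (by positivity)
    calc |2⁻¹ * ‖U y s‖ ^ 2 + P₀ y + 1 / 2 * ⟪y, U y s⟫|
        ≤ |2⁻¹ * ‖U y s‖ ^ 2 + P₀ y| + |1 / 2 * ⟪y, U y s⟫| := abs_add_le _ _
      _ ≤ (|2⁻¹ * ‖U y s‖ ^ 2| + |P₀ y|) + |1 / 2 * ⟪y, U y s⟫| := by gcongr; exact abs_add_le _ _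
      _ ≤ (2⁻¹ * K ^ 2 + K') + 1 / 2 * K := by
          rw [h6, abs_mul, abs_of_pos (by norm_num : (0 : ℝ) < 1 / 2)]
          gcongr
  -- the periodic Liouville theorem kills the dissipation
  have hD := periodic_dissipation_eq_zero (Θ := Θ) (Θt := Θt) (U := W) (D := Dd) (a := 1 / 2) (b := 0) hL hΘper
    hΘcont hΘ2 hΘderiv le_rfl one_half_pos hUb' hΘbdd (fun s y => by positivity) hlaw
  intro s y
  have h := hD s y
  simp only [hDd] at h
  exact norm_eq_zero.1 (pow_eq_zero_iff two_ne_zero |>.1 h)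

/-! ### The class package for a plain (untwisted) discretely self-similar profile -/

/-- **Hypothesis package for a `λ`-DSS Type-I profile (no twist).**  For `v` in the KNSS gauge class `IsTypeIAncientMild D v` with the
space–time Type-I bound `HasTypeIDecay D v` and `IsDiscretelySelfSimilar λ v` (`1 < λ`), the similarity profile `U(y, s) = lerayOrbit v s y`
and the similarity Riesz pressure `P(y, s) = e^{−s} Q[v(−e^{−s})](e^{−s/2} y)` (given pointwise) are: jointly smooth / slice-wise smooth,
`2 log λ`-periodic, a slice-by-slice solution of the time-dependent Leray system with `div U = 0` and the trace Poisson equation, with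
`|U(y, s)| ≤ K/(1+|y|)` for one `K` — the tree package `GaussianHeadPressure.typeI_rdss_corotatingProfile_hypotheses` at twist `θ = 0`
(`IsRotatedDSS λ (rotZLIE 0) v` is plain discrete self-similarity). [cite: PineauVicol2026, (1.14a) (p. 7) and Lemma 7.1 (p. 24)] -/
theorem dss_profile_hypotheses {D lam : ℝ} {v : ℝ → EuclideanSpace ℝ (Fin 3) → EuclideanSpace ℝ (Fin 3)} (hlam : 1 < lam)
    (hA : IsTypeIAncientMild D v) (hdecay : HasTypeIDecay D v) (hdss : IsDiscretelySelfSimilar lam v)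
    {U : EuclideanSpace ℝ (Fin 3) → ℝ → EuclideanSpace ℝ (Fin 3)} {P : EuclideanSpace ℝ (Fin 3) → ℝ → ℝ}
    (hUys : ∀ y s, U y s = lerayOrbit v s y)
    (hPys : ∀ y s, P y s = Real.exp (-s) * pressurePotential (v (-Real.exp (-s))) (Real.exp (-s / 2) • y)) :
    ContDiff ℝ ∞ (fun q : EuclideanSpace ℝ (Fin 3) × ℝ => U q.1 q.2) ∧
    (∀ s, ContDiff ℝ ∞ fun z => P z s) ∧
    (∀ y s, U y (s + 2 * Real.log lam) = U y s) ∧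
    (∀ s y, fderiv ℝ (fun σ => U y σ) s 1 + (1 / 2 : ℝ) • U y s + (1 / 2 : ℝ) • fderiv ℝ (fun z => U z s) y y -
        (Δ (fun z => U z s)) y + convect (fun z => U z s) (fun z => U z s) y + gradient (fun z => P z s) y = 0) ∧
    (∀ s, VectorCalculus.IsDivFree fun z => U z s) ∧
    (∀ s y, ∑ l, pderiv l (pderiv l fun z => P z s) y =
      -∑ l, ∑ j, pderiv l (fun z => U z s j) y * pderiv j (fun z => U z s l) y) ∧
    ∃ K : ℝ, ∀ s y, ‖U y s‖ ≤ K / (1 + ‖y‖) := by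
  -- discrete self-similarity = rotated DSS with the trivial twist
  have hR : IsRotatedDSS lam (rotZLIE (-0)) v := by
    intro t x
    have h := congrFun (congrFun hdss t) x
    rw [nsRescale_apply] at h
    simp only [rotZLIE_symm_apply, rotZLIE_apply, neg_zero, rotZ_zero]
    exact h
  have hUys' : ∀ y s, U y s = rotZ (-(0 / (2 * Real.log lam) * s)) (lerayOrbit v s (rotZ (0 / (2 * Real.log lam) * s) y)) :=
    fun y s => by rw [hUys, zero_div, zero_mul, neg_zero, rotZ_zero, rotZ_zero]
  have hPys' : ∀ y s, P y s = Real.exp (-s) * pressurePotential (v (-Real.exp (-s)))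
      (Real.exp (-s / 2) • rotZ (0 / (2 * Real.log lam) * s) y) :=
    fun y s => by rw [hPys, zero_div, zero_mul, rotZ_zero]
  obtain ⟨hUj, hPsl, hperU, heq, hdivU, hΔP, -, K, hUb, -, -, -, -⟩ :=
    typeI_rdss_corotatingProfile_hypotheses hlam hA hR hdecay hUys' hPys'
  refine ⟨hUj, hPsl, hperU, fun s y => ?_, hdivU, hΔP, K, hUb⟩
  have h := heq s y
  rwa [zero_div, zero_smul, add_zero] at h

/-! ### The registered rung -/

/-- **BC5 RUNG `stub_rung_dssSteadyPressure` (registered stub of crux K2⁺, line `birth`; signature verbatim).**  A `λ`-DSS (`λ > 1`)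
profile of the door class (Type I in time, space–time Type-I decay, continuous on the open backward slab, unit-viscosity Oseen–Duhamel
mild, divergence-free slices) whose similarity Riesz pressure `(−t)·Q[v(t)](√(−t) y)` does not depend on `t` is not backward-singular at
the apex — indeed `v ≡ 0`.  Proof: the class package in Leray variables (`dss_profile_hypotheses`), the uniform bound on the similarity
Riesz pressure (`exists_bound_abs_pressurePotential_lerayOrbit`), `curl_eq_zero_of_steadyPressure_profile`, and the irrotational stratum
(`eq_zero_of_lerayVorticity_eq_zero`, `not_backwardSingular_of_zero`).  Not in print for `λ` away from `1` (tree barrier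
`NearOneDssTypeIExclusion` covers only `λ` near `1`; Tsai 1998 / NRŠ 1996 the self-similar case). [cite: PineauVicol2026, (7.7) (p. 25); Tsai1998, Thm 1] -/
theorem stub_rung_dssSteadyPressure :
    ∀ (C D lam : ℝ) (v : ℝ → EuclideanSpace ℝ (Fin 3) → EuclideanSpace ℝ (Fin 3)), 1 < lam →
    Literature.Analysis.FluidPDE.HasTypeITimeDecay C v →
    Literature.Analysis.FluidPDE.HasTypeIDecay D v →
    ContinuousOn (Function.uncurry v) (Set.Iio (0 : ℝ) ×ˢ Set.univ) →
    (∀ s t : ℝ, s < t → t < 0 → ∀ x, v t x =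
      Literature.Analysis.UnboundedOperators.heatExtension (v s) (t - s) x -
        Literature.Analysis.FluidPDE.oseenDuhamel 1 s v v t x) →
    (∀ t < 0, Literature.Analysis.FluidPDE.VectorCalculus.IsDivFree (v t)) →
    Literature.Analysis.FluidPDE.IsDiscretelySelfSimilar lam v →
    (∀ s t : ℝ, s < 0 → t < 0 → ∀ y : EuclideanSpace ℝ (Fin 3),
      (-s) * Literature.Analysis.FluidPDE.pressurePotential (v s) (Real.sqrt (-s) • y) =
        (-t) * Literature.Analysis.FluidPDE.pressurePotential (v t) (Real.sqrt (-t) • y)) →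
    ¬ Literature.Analysis.FluidPDE.IsBackwardSingularPoint v 0 := by
  intro C D lam v hlam _hrate hdecay hcont hmild hdiv hdss hsteady
  have hlog : 0 < 2 * Real.log lam := by have := Real.log_pos hlam; positivity
  have hD0 : 0 ≤ D := nonneg_of_hasTypeIDecay hdecay
  -- the class membership at the space–time constant `D`
  have hA : IsTypeIAncientMild D v := isTypeIAncientMild_of_class (hdecay.hasTypeITimeDecay hD0) hcont hmild hdiv
  -- the similarity profile and the similarity Riesz pressure, as opaque names
  obtain ⟨U, hU_def⟩ : ∃ U : EuclideanSpace ℝ (Fin 3) → ℝ → EuclideanSpace ℝ (Fin 3), U = fun y s => lerayOrbit v s y :=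
    ⟨_, rfl⟩
  obtain ⟨P, hP_def⟩ : ∃ P : EuclideanSpace ℝ (Fin 3) → ℝ → ℝ,
      P = fun y s => Real.exp (-s) * pressurePotential (v (-Real.exp (-s))) (Real.exp (-s / 2) • y) := ⟨_, rfl⟩
  have hUys : ∀ y s, U y s = lerayOrbit v s y := fun y s => by rw [hU_def]
  have hPys : ∀ y s, P y s = Real.exp (-s) * pressurePotential (v (-Real.exp (-s))) (Real.exp (-s / 2) • y) :=
    fun y s => by rw [hP_def]
  obtain ⟨hUj, hPsl, hperU, heq, hdivU, hΔP, K, hUb⟩ := dss_profile_hypotheses hlam hA hdecay hdss hUys hPys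
  -- the similarity Riesz pressure is steady (hypothesis) and bounded (class)
  have hsq : ∀ σ : ℝ, Real.sqrt (Real.exp (-σ)) = Real.exp (-σ / 2) := fun σ => by
    rw [← exp_neg_half_sq, Real.sqrt_sq (Real.exp_pos _).le]
  have hPτ : ∀ y σ, -(-Real.exp (-σ)) * pressurePotential (v (-Real.exp (-σ))) (Real.sqrt (-(-Real.exp (-σ))) • y) =
      P y σ := fun y σ => by rw [neg_neg, hsq, hPys]
  have hsteadyP : ∀ y s, P y s = P y 0 := by
    intro y s
    rw [← hPτ y s, ← hPτ y 0]
    exact hsteady _ _ (neg_neg_of_pos (Real.exp_pos _)) (neg_neg_of_pos (Real.exp_pos _)) y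
  obtain ⟨MP, -, hMP⟩ := exists_bound_abs_pressurePotential_lerayOrbit D
  have hPb : ∀ y, |P y 0| ≤ MP := by
    intro y
    have hV2 : ContDiff ℝ 2 (v (-Real.exp (-0))) :=
      (hA.contDiff_slice (neg_neg_of_pos (Real.exp_pos _))).of_le (by norm_cast)
    rw [hPys, exp_mul_pressurePotential_eq hdecay 0 hV2 y]
    exact hMP hA hdecay 0 y
  -- the profile is irrotational, hence so is `v`, hence `v ≡ 0`
  have hcurl := curl_eq_zero_of_steadyPressure_profile hlog hUj hPsl hperU heq hdivU hΔP hUb hsteadyP hPb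
  have hΩ : ∀ s y, lerayVorticity v s y = 0 := by
    intro s y
    rw [lerayVorticity_apply, show lerayOrbit v s = fun z => U z s from funext fun z => (hUys z s).symm]
    exact hcurl s y
  exact not_backwardSingular_of_zero (eq_zero_of_lerayVorticity_eq_zero hA hΩ)

end Summit.NavierStokesRegularity.NavierStokesRegularity.Theorems.LocalPressureProfileDoorMonotonePressureProfileRigidityRungDssSteadyPressure

end
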